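import Summits.NavierStokesRegularity.NavierStokesRegularity.Theses.CorkscrewDynamo
import Summits.NavierStokesRegularity.NavierStokesRegularity.Theses.FilamentSkeletonRss
import Literature.Analysis.FluidPDE.KNSSThm53OfWindow
import Literature.Analysis.FluidPDE.AxisymmetricVorticityTransport
import Literature.Analysis.FluidPDE.EulerTimeScaling

/-!
# Route CorkscrewDynamo · crux `CorkscrewProfile` (stmt-NavierStokesRegularity-11282) — an RSS profile is a corkscrew

`corkscrewProfile_of_rssProfileExists : FilamentSkeletonRss.RssProfileExists → CorkscrewDynamo.CorkscrewProfile`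
(registered tools stub `stub_corkscrewProfileOfRssProfileExists` of the line `birth`, lead c2).

The TARGET of route `FilamentSkeletonRss` (stmt-NavierStokesRegularity-16274: a nontrivial `C²` slice `U`,
`α ≠ 0`, and an ancient mild Type-I solution `u` with `u(−1) = U` which is rotated discretely self-similar
for EVERY factor `c > 0` with the rotation `R(−2α log c)` about `e₃`) implies route `CorkscrewDynamo`'s crux
`CorkscrewProfile` (a nontrivial Type-I ancient mild solution, rotated `c`-DSS about `e₃` for ONE `c > 1`,
with ESSENTIAL rotation). No regularity theory is needed, only continuity of `U` and one Liouville theorem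
of the tree:

* the slices of `u` are `u(−c², z) = c⁻¹ R_c U(c⁻¹ R_c⁻¹ z)` (`slice_eq_of_isRotatedDSS`), so at `t = −1`
  plain `c`-DSS reads `R_c U R_c⁻¹ = U` a.e., i.e. — both sides being continuous — equivariance of `U`
  under the rotation by `−2α log c`;
* if `U` is equivariant under ALL rotations about `e₃` then every slice of `u` is axisymmetric and
  self-similar, the time-shift `u(· − ½)` is a BOUNDED axisymmetric ancient mild solution with
  `r‖u‖ ≤ C₀`, and KNSS 2009 Thm 5.3 (tree theorem `knss_bound_C_over_r_holds`) forces `u(−1) = U = 0`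
  a.e., hence everywhere: contradiction (`rssProfile_eq_zero_of_axisymmetric`);
* otherwise `U` fails to be equivariant under some angle `ψ` and under `−ψ`, and the factor
  `c = exp(−ψ/(2α)) > 1` (sign of `ψ` chosen) has `−2α log c = ψ`: for this `c` the rotation is essential.
-/

noncomputable section

open Set Function MeasureTheory Literature.Analysis.FluidPDE

namespace Summit.NavierStokesRegularity.NavierStokesRegularity.Theorems.CorkscrewProfile.Birth

set_option linter.dupNamespace false

/-! ### Rotations pinned on the standard basis -/

/-- A linear isometry pinned on the standard basis to the rotation by `θ` about `e₃` IS `rotZ θ`. -/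
theorem rot_apply_eq_rotZ_of_basis
    {Rot : ℝ → (EuclideanSpace ℝ (Fin 3) ≃ₗᵢ[ℝ] EuclideanSpace ℝ (Fin 3))}
    (hRot : ∀ θ : ℝ, Rot θ (EuclideanSpace.single 0 1) =
        Real.cos θ • EuclideanSpace.single 0 1 + Real.sin θ • EuclideanSpace.single 1 1 ∧
      Rot θ (EuclideanSpace.single 1 1) =
        -(Real.sin θ • EuclideanSpace.single 0 1) + Real.cos θ • EuclideanSpace.single 1 1 ∧
      Rot θ (EuclideanSpace.single 2 1) = EuclideanSpace.single 2 1)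
    (θ : ℝ) (x : EuclideanSpace ℝ (Fin 3)) : Rot θ x = rotZ θ x := by
  obtain ⟨h0, h1, h2⟩ := hRot θ
  have hx : x = x 0 • EuclideanSpace.single (0 : Fin 3) (1 : ℝ) + x 1 • EuclideanSpace.single (1 : Fin 3) (1 : ℝ)
      + x 2 • EuclideanSpace.single (2 : Fin 3) (1 : ℝ) := by
    ext i
    fin_cases i <;> simp
  conv_lhs => rw [hx]
  rw [map_add, map_add, map_smul, map_smul, map_smul, h0, h1, h2]
  ext i
  fin_cases i <;> simp <;> ring

/-- The inverse of a pinned rotation: `(Rot θ)⁻¹ = rotZ (−θ)`. -/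
theorem rot_symm_apply_eq_rotZ_of_basis
    {Rot : ℝ → (EuclideanSpace ℝ (Fin 3) ≃ₗᵢ[ℝ] EuclideanSpace ℝ (Fin 3))}
    (hRot : ∀ θ : ℝ, Rot θ (EuclideanSpace.single 0 1) =
        Real.cos θ • EuclideanSpace.single 0 1 + Real.sin θ • EuclideanSpace.single 1 1 ∧
      Rot θ (EuclideanSpace.single 1 1) =
        -(Real.sin θ • EuclideanSpace.single 0 1) + Real.cos θ • EuclideanSpace.single 1 1 ∧
      Rot θ (EuclideanSpace.single 2 1) = EuclideanSpace.single 2 1)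
    (θ : ℝ) (x : EuclideanSpace ℝ (Fin 3)) : (Rot θ).symm x = rotZ (-θ) x := by
  apply (Rot θ).injective
  rw [LinearIsometryEquiv.apply_symm_apply, rot_apply_eq_rotZ_of_basis hRot, ← rotZ_add, add_neg_cancel,
    rotZ_zero]

/-! ### The slices of a rotated self-similar field -/

/-- **Slices of a rotated-DSS field through a later slice**: `u(c²t, z) = c⁻¹ R u(t, c⁻¹ R⁻¹ z)`. -/
theorem slice_eq_of_isRotatedDSS {c : ℝ} (hc : 0 < c)
    {R : EuclideanSpace ℝ (Fin 3) ≃ₗᵢ[ℝ] EuclideanSpace ℝ (Fin 3)}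
    {u : ℝ → EuclideanSpace ℝ (Fin 3) → EuclideanSpace ℝ (Fin 3)} (h : IsRotatedDSS c R u)
    (t : ℝ) (z : EuclideanSpace ℝ (Fin 3)) :
    u (c ^ 2 * t) z = c⁻¹ • R (u t (c⁻¹ • R.symm z)) := by
  have key := h t (c⁻¹ • R.symm z)
  have e : c • R (c⁻¹ • R.symm z) = z := by
    rw [map_smul, LinearIsometryEquiv.apply_symm_apply, smul_smul, mul_inv_cancel₀ hc.ne', one_smul]
  rw [e] at key
  have key2 := congrArg (⇑R) key
  simp only [map_smul, LinearIsometryEquiv.apply_symm_apply] at key2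
  rw [← key2, smul_smul, inv_mul_cancel₀ hc.ne', one_smul]

/-! ### An RSS profile is not axisymmetric -/

/-- **A nontrivial Type-I RSS profile is not axisymmetric** (KNSS 2009 Thm 5.3 through a time shift).
In the setting of `RssProfileExists` — `U` continuous, `u(−1) = U`, `u` ancient mild with measurable
slices, Type-I with constant `C₀`, rotated-DSS for every factor `c > 0` with the pinned rotations
`Rot (−2α log c)` — if `U` is equivariant under every rotation about `e₃` then `U = 0`: every slice
`u(−c²) = c⁻¹ U(c⁻¹ ·)` is axisymmetric, the shifted field `u(· − ½)` is a bounded axisymmetric ancient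
mild solution with `r ‖u‖ ≤ C₀`, hence zero a.e. on every slice (`knss_bound_C_over_r_holds`), so
`U = u(−1)` vanishes a.e. and, being continuous, everywhere. -/
theorem rssProfile_eq_zero_of_axisymmetric {α C₀ : ℝ}
    {U : EuclideanSpace ℝ (Fin 3) → EuclideanSpace ℝ (Fin 3)}
    {Rot : ℝ → (EuclideanSpace ℝ (Fin 3) ≃ₗᵢ[ℝ] EuclideanSpace ℝ (Fin 3))}
    {u : ℝ → EuclideanSpace ℝ (Fin 3) → EuclideanSpace ℝ (Fin 3)}
    (hRot : ∀ θ : ℝ, Rot θ (EuclideanSpace.single 0 1) =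
        Real.cos θ • EuclideanSpace.single 0 1 + Real.sin θ • EuclideanSpace.single 1 1 ∧
      Rot θ (EuclideanSpace.single 1 1) =
        -(Real.sin θ • EuclideanSpace.single 0 1) + Real.cos θ • EuclideanSpace.single 1 1 ∧
      Rot θ (EuclideanSpace.single 2 1) = EuclideanSpace.single 2 1)
    (hUc : Continuous U) (hslice : u (-1) = U)
    (hrdss : ∀ c : ℝ, 0 < c → IsRotatedDSS c (Rot (-(α * (2 * Real.log c)))) u)
    (hmild : IsAncientMildSolution 1 u) (hmeas : ∀ t < 0, AEStronglyMeasurable (u t) volume)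
    (hTI : HasTypeIDecay C₀ u)
    (hax : ∀ (φ : ℝ) (y : EuclideanSpace ℝ (Fin 3)), U (rotZ φ y) = rotZ φ (U y)) : U = 0 := by
  -- the slices: `u (−c²) z = c⁻¹ U (c⁻¹ z)`
  have hsl : ∀ c : ℝ, 0 < c → ∀ z : EuclideanSpace ℝ (Fin 3), u (-(c ^ 2)) z = c⁻¹ • U (c⁻¹ • z) := by
    intro c hc z
    have h := slice_eq_of_isRotatedDSS hc (hrdss c hc) (-1) z
    rw [mul_neg_one, hslice, rot_apply_eq_rotZ_of_basis hRot, rot_symm_apply_eq_rotZ_of_basis hRot,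
      neg_neg] at h
    rw [h]
    congr 1
    rw [← rotZ_smul, hax, ← rotZ_add, neg_add_cancel, rotZ_zero]
  have hsl' : ∀ t < 0, ∀ z : EuclideanSpace ℝ (Fin 3),
      u t z = (Real.sqrt (-t))⁻¹ • U ((Real.sqrt (-t))⁻¹ • z) := by
    intro t ht z
    have hc : 0 < Real.sqrt (-t) := Real.sqrt_pos.2 (by linarith)
    have h := hsl _ hc z
    rwa [Real.sq_sqrt (by linarith), neg_neg] at h
  -- `0 ≤ C₀`
  have hC₀ : 0 ≤ C₀ := by
    have h := hTI (-1) (by norm_num) 0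
    have hden : 0 < ‖(0 : EuclideanSpace ℝ (Fin 3))‖ + Real.sqrt (-(-1 : ℝ)) := by
      rw [norm_zero, zero_add, neg_neg, Real.sqrt_one]; exact one_pos
    exact (div_nonneg_iff.1 ((norm_nonneg _).trans h)).elim (fun h' => h'.1)
      (fun h' => absurd h'.2 (not_le.2 hden))
  -- the shifted field `v t = u (t − ½)`
  set v : ℝ → EuclideanSpace ℝ (Fin 3) → EuclideanSpace ℝ (Fin 3) := fun t => u (t + -(1 / 2 : ℝ)) with hv
  have hvmild : IsAncientMildSolution 1 v := by
    refine ⟨fun t ht => ?_, fun s t hst ht => ?_⟩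
    · exact hmild.1 _ (by linarith)
    · exact (hmild.2 (s + -(1 / 2 : ℝ)) (t + -(1 / 2 : ℝ)) (by linarith) (by linarith)).comp_add_right_zero
  have hvbdd : IsBoundedOn (Iio 0) v := by
    refine ⟨C₀ / Real.sqrt (1 / 2), fun t ht x => ?_⟩
    have ht' : t + -(1 / 2 : ℝ) < 0 := by have : t < 0 := ht; linarith
    have hs : Real.sqrt (1 / 2) ≤ Real.sqrt (-(t + -(1 / 2 : ℝ))) :=
      Real.sqrt_le_sqrt (by have : t < 0 := ht; linarith)
    have hs0 : 0 < Real.sqrt (1 / 2) := Real.sqrt_pos.2 (by norm_num)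
    calc ‖v t x‖ = ‖u (t + -(1 / 2 : ℝ)) x‖ := rfl
      _ ≤ C₀ / (‖x‖ + Real.sqrt (-(t + -(1 / 2 : ℝ)))) := hTI _ ht' x
      _ ≤ C₀ / Real.sqrt (1 / 2) := by
          apply div_le_div_of_nonneg_left hC₀ hs0
          linarith [norm_nonneg x]
  have hvmeas : ∀ t < 0, AEStronglyMeasurable (v t) volume := fun t ht => hmeas _ (by linarith)
  have hvax : ∀ t < 0, IsAxisymmetric (v t) := by
    intro t ht θ x
    have ht' : t + -(1 / 2 : ℝ) < 0 := by linarith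
    show u (t + -(1 / 2 : ℝ)) (rotZ θ x) = rotZ θ (u (t + -(1 / 2 : ℝ)) x)
    rw [hsl' _ ht', hsl' _ ht', ← rotZ_smul, hax, rotZ_smul]
  have hvC : ∃ C : ℝ, ∀ t < 0, ∀ x, cylRadius x * ‖v t x‖ ≤ C := by
    refine ⟨C₀, fun t ht x => ?_⟩
    have ht' : t + -(1 / 2 : ℝ) < 0 := by linarith
    have hs : 0 < Real.sqrt (-(t + -(1 / 2 : ℝ))) := Real.sqrt_pos.2 (by linarith)
    have hden : 0 < ‖x‖ + Real.sqrt (-(t + -(1 / 2 : ℝ))) := by positivity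
    have hcyl : cylRadius x ≤ ‖x‖ := by
      rw [cylRadius, EuclideanSpace.norm_eq]
      apply Real.sqrt_le_sqrt
      simp only [Fin.sum_univ_three, Real.norm_eq_abs, sq_abs]
      nlinarith [sq_nonneg (x 2)]
    calc cylRadius x * ‖v t x‖ ≤ ‖x‖ * (C₀ / (‖x‖ + Real.sqrt (-(t + -(1 / 2 : ℝ))))) :=
          mul_le_mul hcyl (hTI _ ht' x) (norm_nonneg _) (norm_nonneg _)
      _ = C₀ * (‖x‖ / (‖x‖ + Real.sqrt (-(t + -(1 / 2 : ℝ))))) := by ring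
      _ ≤ C₀ * 1 := by
          apply mul_le_mul_of_nonneg_left _ hC₀
          rw [div_le_one hden]
          linarith [hs.le]
      _ = C₀ := mul_one _
  have hzero := knss_bound_C_over_r_holds ⟨hvmild, hvbdd⟩ hvmeas hvax hvC (-(1 / 2 : ℝ)) (by norm_num)
  -- `U = u(−1) = v(−½)` vanishes a.e., hence everywhere
  have hU : U =ᵐ[volume] (0 : EuclideanSpace ℝ (Fin 3) → EuclideanSpace ℝ (Fin 3)) := by
    have e : v (-(1 / 2 : ℝ)) = U := by
      rw [← hslice]
      show u (-(1 / 2 : ℝ) + -(1 / 2 : ℝ)) = u (-1)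
      norm_num
    rw [← e]
    exact hzero
  exact (Continuous.ae_eq_iff_eq volume hUc continuous_const).1 hU

/-! ### The bridge -/

/-- **Registered tools stub `stub_corkscrewProfileOfRssProfileExists` — an RSS profile is a corkscrew.**
The target `RssProfileExists` of route `FilamentSkeletonRss` (stmt-NavierStokesRegularity-16274) implies
route `CorkscrewDynamo`'s crux `CorkscrewProfile`: the profile `U` is not axisymmetric
(`rssProfile_eq_zero_of_axisymmetric`), so it fails to be equivariant under some angle `ψ` (and `−ψ`);
for the factor `c = exp(−ψ/(2α)) > 1` the field `u` is rotated `c`-DSS about `e₃` with the rotation by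
`−2α log c = ψ`, pinned by coordinates, and NOT plainly `c`-DSS at `t = −1` (that would be equivariance
of the continuous `U` under `ψ`); nontriviality because `U = u(−1) ≠ 0` is continuous. -/
theorem stub_corkscrewProfileOfRssProfileExists :
    Summit.NavierStokesRegularity.NavierStokesRegularity.Theses.FilamentSkeletonRss.RssProfileExists →
      Summit.NavierStokesRegularity.NavierStokesRegularity.Theses.CorkscrewDynamo.CorkscrewProfile := by
  rintro ⟨α, C₀, U, Rot, u, hα, hRot, hU2, hU0, hslice, hrdss, hmild, hmeas, hTI⟩
  have hUc : Continuous U := hU2.continuous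
  -- `U` is not axisymmetric
  have hnax : ∃ (φ : ℝ) (y : EuclideanSpace ℝ (Fin 3)), U (rotZ φ y) ≠ rotZ φ (U y) := by
    by_contra hcon
    push Not at hcon
    exact hU0 (rssProfile_eq_zero_of_axisymmetric hRot hUc hslice hrdss hmild hmeas hTI hcon)
  obtain ⟨φ, y, hy⟩ := hnax
  -- non-equivariance under `−φ` as well
  have hy' : U (rotZ (-φ) (rotZ φ y)) ≠ rotZ (-φ) (U (rotZ φ y)) := by
    rw [← rotZ_add, neg_add_cancel, rotZ_zero]
    intro h'
    apply hy
    rw [h', ← rotZ_add, add_neg_cancel, rotZ_zero]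
  -- an angle `ψ` of non-equivariance with `−ψ/(2α) > 0`
  obtain ⟨ψ, z, hz, hψ⟩ : ∃ (ψ : ℝ) (z : EuclideanSpace ℝ (Fin 3)),
      U (rotZ ψ z) ≠ rotZ ψ (U z) ∧ 0 < -ψ / (2 * α) := by
    have hφ : φ ≠ 0 := by
      rintro rfl
      rw [rotZ_zero, rotZ_zero] at hy
      exact hy rfl
    by_cases hs : 0 < -φ / (2 * α)
    · exact ⟨φ, y, hy, hs⟩
    · refine ⟨-φ, rotZ φ y, hy', ?_⟩
      have hne : -φ / (2 * α) ≠ 0 := div_ne_zero (neg_ne_zero.2 hφ) (mul_ne_zero two_ne_zero hα)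
      have hlt : -φ / (2 * α) < 0 := lt_of_le_of_ne (not_lt.1 hs) hne
      rw [neg_neg]
      have e : φ / (2 * α) = -(-φ / (2 * α)) := by ring
      rw [e]; linarith
  -- the factor
  set c : ℝ := Real.exp (-ψ / (2 * α)) with hc_def
  have hc0 : 0 < c := Real.exp_pos _
  have hc1 : 1 < c := Real.one_lt_exp_iff.2 hψ
  have hθ : -(α * (2 * Real.log c)) = ψ := by
    rw [hc_def, Real.log_exp]; field_simp
  set R := Rot (-(α * (2 * Real.log c))) with hR
  have hRz : ∀ x, R x = rotZ ψ x := fun x => by rw [hR, rot_apply_eq_rotZ_of_basis hRot, hθ]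
  have hRs : ∀ x, R.symm x = rotZ (-ψ) x := fun x => by rw [hR, rot_symm_apply_eq_rotZ_of_basis hRot, hθ]
  refine ⟨c, ψ, R, u, hc1, fun x => ?_, hmild, hmeas, hrdss c hc0, ⟨C₀, hTI⟩, ?_, ?_⟩
  · rw [hRz]
    exact ⟨rotZ_apply_zero ψ x, rotZ_apply_one ψ x, rotZ_apply_two ψ x⟩
  · -- essential rotation: plain `c`-DSS at `t = −1` would make `U` equivariant under `ψ`
    intro hall
    have hae := hall (-1) (by norm_num)
    have hresc : ∀ w, nsRescale c u (-1) w = rotZ ψ (U (rotZ (-ψ) w)) := by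
      intro w
      rw [nsRescale_apply]
      have h := slice_eq_of_isRotatedDSS hc0 (hrdss c hc0) (-1) (c • w)
      rw [map_smul, smul_smul, inv_mul_cancel₀ hc0.ne', one_smul, hslice] at h
      rw [h, smul_smul, mul_inv_cancel₀ hc0.ne', one_smul, hRz, hRs]
    have hae' : (fun w => rotZ ψ (U (rotZ (-ψ) w))) =ᵐ[volume] U := by
      have e : nsRescale c u (-1) = fun w => rotZ ψ (U (rotZ (-ψ) w)) := funext hresc
      rw [← e, ← hslice]
      exact hae
    have hcont : Continuous fun w => rotZ ψ (U (rotZ (-ψ) w)) := by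
      have h1 : Continuous fun w : EuclideanSpace ℝ (Fin 3) => rotZ (-ψ) w := (rotZLIE (-ψ)).continuous
      have h2 : Continuous fun w : EuclideanSpace ℝ (Fin 3) => rotZ ψ w := (rotZLIE ψ).continuous
      exact h2.comp (hUc.comp h1)
    have heq := (Continuous.ae_eq_iff_eq volume hcont hUc).1 hae'
    apply hz
    have h := congrFun heq (rotZ ψ z)
    rw [← rotZ_add, neg_add_cancel, rotZ_zero] at h
    exact h.symm
  · -- nontriviality: `U = u(−1) ≠ 0` is continuous
    intro hall
    apply hU0
    have hae := hall (-1) (by norm_num)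
    rw [hslice] at hae
    exact (Continuous.ae_eq_iff_eq volume hUc continuous_const).1 hae

/-- **An RSS profile is a corkscrew** (named form of the registered stub). -/
theorem corkscrewProfile_of_rssProfileExists
    (h : Summit.NavierStokesRegularity.NavierStokesRegularity.Theses.FilamentSkeletonRss.RssProfileExists) :
    Summit.NavierStokesRegularity.NavierStokesRegularity.Theses.CorkscrewDynamo.CorkscrewProfile :=
  stub_corkscrewProfileOfRssProfileExists h

end Summit.NavierStokesRegularity.NavierStokesRegularity.Theorems.CorkscrewProfile.Birth
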